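import Literature.NumberTheory.EllipticCurves.NewformPeterssonSizeSymmSquareProofs
import Literature.NumberTheory.EllipticCurves.SharpFlatPAdicLFunctionCoeffField
import Literature.NumberTheory.Automorphic.Sweep1
import Mathlib.NumberTheory.Padics.Complex
import HarnessLib

/-!
# Sketch — stub-ideation k4 g13 (crux `(R≥)ᵖ` = stmt-…-26074; stub `stub_cmLambdaLower` = RSL_g = stmt-…-22608)

TECHNIQUE family 3 «assume the opposite»: suppose some level prime `ℓ ∥ M` (exactly divides).
BSD is NOT proved by any of this; nothing here touches the route file, the skeleton or any registry.

§A  the LEVEL BRACKET of `RSL_g`'s exponent `Σ_g(S₀)` at a prime `ℓ ∣ M`,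
    `[‖ι a_ℓ(g) − 1‖₂ < 1]`, is LEVEL-EXACT at `p = 2` for a weight-two `Γ₀(M)`-newform:
    it equals `[¬ ℓ² ∣ M]` — BOTH signs `a_ℓ = ±1` fire because `‖2‖₂ < 1` (at odd `p` only `+1` would).
§B  the one missing PRINT input this exposes, typed two (kernel-equivalent) ways:
    `CMNewformLevelSquarefull` (LVsq) ↔ `CMNewformLevelCoeffVanishing` (LV0 = k4-g5's H-B1).
§C  consequences for the exponent: under LVsq the level part of `Σ_g(S₀)` is `0` (uniform road closes);
    without it, a place with `ℓ ∥ M` contributes `2^{n_ℓ} ≥ 1` that no binder of `RSL_g` supplies.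
-/

set_option linter.dupNamespace false

noncomputable section

open scoped MatrixGroups ModularForm
open CongruenceSubgroup
open Literature.NumberTheory.EllipticCurves
open Literature.NumberTheory.EllipticCurves.ModularForms
open Literature.NumberTheory.Automorphic (IsCMForm)

namespace Summit.BirchSwinnertonDyer.BirchSwinnertonDyer.Cruxes.ResidualThetaCountLowerPureAtTwo.SideaK4G13

/-! ## §B  The missing print input, typed two ways -/

/-- **LVsq** (PRINT fact, to be held by name — see the card §2 for where):
a weight-two newform on `Γ₀(M)` (trivial Nebentypus) with complex multiplication has SQUAREFULL level:
every prime dividing `M` divides it at least twice.  Print chain: Ribet 1977 (LNM 601) Prop. (4.4),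
Thm. (4.5) (`g` comes from a Grössencharacter `ψ` of an imaginary quadratic `F`), Thm. (3.4),
Cor. (3.5), Remark (3.5) [Shimura] (`θ_ψ` is new of level `|d_F|·N(𝔣_ψ)`, character `η·φ`);
trivial character `η·φ = 1` forces `𝔩 ∣ 𝔣_ψ` at ramified `ℓ`, `𝔩𝔩̄ ∣ 𝔣_ψ` at split `ℓ ∣ N𝔣_ψ`,
and `ℓ² = N(ℓ) ∣ N𝔣_ψ` at inert `ℓ ∣ N𝔣_ψ`. -/
def CMNewformLevelSquarefull : Prop :=
  ∀ (M : ℕ) [NeZero M] (g : CuspForm (Gamma0 M) 2), IsNewform0 g → IsCMForm (liftToGamma1 M 2 g) →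
    ∀ ℓ : ℕ, ℓ.Prime → ℓ ∣ M → ℓ ^ 2 ∣ M

/-- **LV0** (= idea k4-g5's `H-B1`, "cite-level"): the level coefficients of a CM newform on `Γ₀(M)`
vanish.  Kernel-equivalent to `CMNewformLevelSquarefull` (`levelCoeffVanishing_iff_levelSquarefull`). -/
def CMNewformLevelCoeffVanishing : Prop :=
  ∀ (M : ℕ) [NeZero M] (g : CuspForm (Gamma0 M) 2), IsNewform0 g → IsCMForm (liftToGamma1 M 2 g) →
    ∀ ℓ : ℕ, ℓ.Prime → ℓ ∣ M → cuspCoeff g ℓ = 0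

variable {M : ℕ} [NeZero M] {g : CuspForm (Gamma0 M) 2}

/-- Pointwise kernel dichotomy at a level prime (tree: Atkin–Lehner `a_ℓ = 0` if `ℓ² ∣ M`,
`a_ℓ² = 1` if `ℓ ∥ M`): `a_ℓ(g) = 0 ↔ ℓ² ∣ M`.  No CM hypothesis. -/
theorem cuspCoeff_eq_zero_iff_sq_dvd (hg : IsNewform0 g) {ℓ : ℕ} (hℓ : ℓ.Prime) (hℓM : ℓ ∣ M) :
    cuspCoeff g ℓ = 0 ↔ ℓ ^ 2 ∣ M := by
  refine ⟨fun h0 ↦ ?_, fun h2 ↦ hg.cuspCoeff_eq_zero_of_sq_dvd hℓ h2⟩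
  by_contra h2
  have h1 := hg.cuspCoeff_sq_eq_one_of_dvd_of_not_sq_dvd hℓ hℓM h2
  rw [h0] at h1
  norm_num at h1

/-- At a prime `ℓ ∥ M` the coefficient is a SIGN: `a_ℓ(g) = 1 ∨ a_ℓ(g) = -1`. -/
theorem cuspCoeff_eq_one_or_eq_neg_one (hg : IsNewform0 g) {ℓ : ℕ} (hℓ : ℓ.Prime) (hℓM : ℓ ∣ M)
    (h2 : ¬ ℓ ^ 2 ∣ M) : cuspCoeff g ℓ = 1 ∨ cuspCoeff g ℓ = -1 := by
  have h1 := hg.cuspCoeff_sq_eq_one_of_dvd_of_not_sq_dvd hℓ hℓM h2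
  exact mul_self_eq_one_iff.1 (by rw [← pow_two]; exact h1)

/-- The two typings of the missing input are ONE fact in the kernel. -/
theorem levelCoeffVanishing_iff_levelSquarefull :
    CMNewformLevelCoeffVanishing ↔ CMNewformLevelSquarefull := by
  constructor
  · intro h M _ g hg hcm ℓ hℓ hℓM
    exact (cuspCoeff_eq_zero_iff_sq_dvd hg hℓ hℓM).1 (h M g hg hcm ℓ hℓ hℓM)
  · intro h M _ g hg hcm ℓ hℓ hℓM
    exact (cuspCoeff_eq_zero_iff_sq_dvd hg hℓ hℓM).2 (h M g hg hcm ℓ hℓ hℓM)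

/-! ## §A  The level bracket is level-exact at `p = 2` -/

/-- `‖2‖ < 1` in `ℚ̄₂` — the reason BOTH signs `a_ℓ = ±1` fire the bracket at `p = 2`. -/
theorem norm_two_lt_one : ‖(2 : PadicAlgCl 2)‖ < 1 := by
  have h : (algebraMap ℚ_[2] (PadicAlgCl 2)) 2 = (2 : PadicAlgCl 2) := map_ofNat _ 2
  have h2 : ‖(2 : ℚ_[2])‖ = (2 : ℝ)⁻¹ := by exact_mod_cast Padic.norm_p (p := 2)
  rw [← h, PadicAlgCl.norm_extends, h2]
  norm_num

variable (ι : coeffField g →+* PadicAlgCl 2)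

/-- `ℓ² ∣ M` ⇒ `ι a_ℓ = 0` ⇒ `‖ι a_ℓ − 1‖ = 1`: the bracket is `0`. -/
theorem levelBracket_eq_zero_of_sq_dvd (hg : IsNewform0 g) {ℓ : ℕ} (hℓ : ℓ.Prime) (h2 : ℓ ^ 2 ∣ M) :
    (if ‖embCoeff g ι ℓ - 1‖ < 1 then 1 else 0 : ℕ) = 0 := by
  have h0 : embCoeff g ι ℓ = (0 : ℤ) :=
    embCoeff_eq_intCast g ι (a := 0) (by simpa using hg.cuspCoeff_eq_zero_of_sq_dvd hℓ h2)
  simp [h0]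

/-- `ℓ ∥ M` ⇒ `ι a_ℓ = ±1` ⇒ `‖ι a_ℓ − 1‖ ∈ {0, ‖2‖₂ = ½}`: the bracket is `1` (p = 2 is essential). -/
theorem levelBracket_eq_one_of_not_sq_dvd (hg : IsNewform0 g) {ℓ : ℕ} (hℓ : ℓ.Prime) (hℓM : ℓ ∣ M)
    (h2 : ¬ ℓ ^ 2 ∣ M) : (if ‖embCoeff g ι ℓ - 1‖ < 1 then 1 else 0 : ℕ) = 1 := by
  rcases cuspCoeff_eq_one_or_eq_neg_one hg hℓ hℓM h2 with h | h
  · have h1 : embCoeff g ι ℓ = (1 : ℤ) := embCoeff_eq_intCast g ι (a := 1) (by simpa using h)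
    simp [h1]
  · have h1 : embCoeff g ι ℓ = (-1 : ℤ) := embCoeff_eq_intCast g ι (a := -1) (by simpa using h)
    have hn : ‖embCoeff g ι ℓ - 1‖ < 1 := by
      rw [h1, Int.cast_neg, Int.cast_one, show (-1 : PadicAlgCl 2) - 1 = -2 by norm_num, norm_neg]
      exact norm_two_lt_one
    simp [hn]

/-- **F1.** For a weight-two `Γ₀(M)`-newform and a level prime `ℓ ∣ M`, at `p = 2`:
`[‖ι a_ℓ − 1‖₂ < 1] = [¬ ℓ² ∣ M]`.  No CM hypothesis; the bracket is NOT dead code. -/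
theorem levelBracket_eq (hg : IsNewform0 g) {ℓ : ℕ} (hℓ : ℓ.Prime) (hℓM : ℓ ∣ M) :
    (if ‖embCoeff g ι ℓ - 1‖ < 1 then 1 else 0 : ℕ) = if ℓ ^ 2 ∣ M then 0 else 1 := by
  by_cases h2 : ℓ ^ 2 ∣ M
  · rw [if_pos h2]; exact levelBracket_eq_zero_of_sq_dvd ι hg hℓ h2
  · rw [if_neg h2]; exact levelBracket_eq_one_of_not_sq_dvd ι hg hℓ hℓM h2

/-! ## §C  Consequences for the exponent `Σ_g(S₀)` (summand as a function of the place's prime `ℓ`) -/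

/-- The `RSL_g` summand at a place with prime `ℓ` (route file l.508, with `natGenerator v ↦ ℓ`). -/
def sigmaSummand (ℓ : ℕ) : ℕ :=
  2 ^ padicValNat 2 ((ℓ ^ 2 - 1) / 8) *
    (if ℓ ∣ M then (if ‖embCoeff g ι ℓ - 1‖ < 1 then 1 else 0)
      else (if ‖embCoeff g ι ℓ‖ < 1 then 2 else 0))

/-- Level-exact form of the summand: the level branch is `[¬ ℓ² ∣ M]`, computable from `M` alone. -/
theorem sigmaSummand_eq (hg : IsNewform0 g) {ℓ : ℕ} (hℓ : ℓ.Prime) :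
    sigmaSummand (M := M) ι ℓ =
      2 ^ padicValNat 2 ((ℓ ^ 2 - 1) / 8) *
        (if ℓ ∣ M then (if ℓ ^ 2 ∣ M then 0 else 1) else (if ‖embCoeff g ι ℓ‖ < 1 then 2 else 0)) := by
  unfold sigmaSummand
  by_cases hℓM : ℓ ∣ M
  · rw [if_pos hℓM, if_pos hℓM, levelBracket_eq ι hg hℓ hℓM]
  · rw [if_neg hℓM, if_neg hℓM]

/-- Under LVsq (here as the local hypothesis `hsq`) every level summand vanishes: the UNIFORM road. -/
theorem sigmaSummand_eq_zero_of_dvd (hg : IsNewform0 g) (hsq : ∀ ℓ : ℕ, ℓ.Prime → ℓ ∣ M → ℓ ^ 2 ∣ M)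
    {ℓ : ℕ} (hℓ : ℓ.Prime) (hℓM : ℓ ∣ M) : sigmaSummand (M := M) ι ℓ = 0 := by
  rw [sigmaSummand_eq ι hg hℓ, if_pos hℓM, if_pos (hsq ℓ hℓ hℓM), mul_zero]

/-- Hence the exponent is its GOOD part: `Σ_g(S₀) = Σ_{v ∈ S₀, ℓ_v ∤ M} 2^{n_v}·[‖ι a_ℓ‖<1]·2`. -/
theorem sigma_eq_good_part {α : Type*} (S₀ : Finset α) (prime : α → ℕ)
    (hprime : ∀ v ∈ S₀, (prime v).Prime) (hg : IsNewform0 g)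
    (hsq : ∀ ℓ : ℕ, ℓ.Prime → ℓ ∣ M → ℓ ^ 2 ∣ M) :
    ∑ v ∈ S₀, sigmaSummand (M := M) ι (prime v) =
      ∑ v ∈ S₀ with ¬ prime v ∣ M, sigmaSummand (M := M) ι (prime v) := by
  rw [Finset.sum_filter]
  refine Finset.sum_congr rfl fun v hv ↦ ?_
  by_cases h : prime v ∣ M
  · rw [if_neg (not_not.2 h)]; exact sigmaSummand_eq_zero_of_dvd ι hg hsq (hprime v hv) h
  · rw [if_pos h]

/-- **F2 (the obstruction, assume-the-opposite).** If some place of `S₀` has prime `ℓ ∥ M`, its summand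
is `2^{n_ℓ} ≥ 1`: a positive demand on `#Sel[ϖ]` about which NO binder of `RSL_g` speaks
(`ρ`-hypotheses only at `ℓ ∤ 2M`, congruence only off `2·M·N_W`, `Θ` only at `2`). -/
theorem one_le_sigmaSummand_of_exactlyDvd (hg : IsNewform0 g) {ℓ : ℕ} (hℓ : ℓ.Prime) (hℓM : ℓ ∣ M)
    (h2 : ¬ ℓ ^ 2 ∣ M) : 1 ≤ sigmaSummand (M := M) ι ℓ := by
  rw [sigmaSummand_eq ι hg hℓ, if_pos hℓM, if_neg h2, mul_one]
  exact Nat.one_le_two_pow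

/-- … so the exponent of `RSL_g` is at least `d + 1` as soon as ONE `ℓ ∥ M` lies in `S₀`
(and `S₀ ⊇ primes(M)` is a binder of `RSL_g`, so every level prime does). -/
theorem lt_sigma_of_exactlyDvd {α : Type*} (S₀ : Finset α) (prime : α → ℕ) (hg : IsNewform0 g)
    {v : α} (hv : v ∈ S₀) (hℓ : (prime v).Prime) (hℓM : prime v ∣ M) (h2 : ¬ prime v ^ 2 ∣ M) (d : ℕ) :
    d < d + ∑ w ∈ S₀, sigmaSummand (M := M) ι (prime w) := by
  have h1 := one_le_sigmaSummand_of_exactlyDvd ι hg hℓ hℓM h2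
  have h2' : sigmaSummand (M := M) ι (prime v) ≤ ∑ w ∈ S₀, sigmaSummand (M := M) ι (prime w) :=
    Finset.single_le_sum (f := fun w ↦ sigmaSummand (M := M) ι (prime w)) (fun _ _ ↦ Nat.zero_le _) hv
  omega

/-! ## §D  How the fact must ARRIVE (it cannot be proved inside a fixed-signature kernel stub):
as a hypothesis.  The binder shape a split-time kernel stub would take: -/

/-- Shape of the hypothesis the kernel supply stub needs at level primes (LVsq instantiated at `g`);
`CMNewformLevelSquarefull → LevelSquarefullAt g` is `fun h hg hcm ↦ h M g hg hcm`. -/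
def LevelSquarefullAt (g : CuspForm (Gamma0 M) 2) : Prop :=
  IsNewform0 g → IsCMForm (liftToGamma1 M 2 g) → ∀ ℓ : ℕ, ℓ.Prime → ℓ ∣ M → ℓ ^ 2 ∣ M

theorem levelSquarefullAt_of (h : CMNewformLevelSquarefull) (g : CuspForm (Gamma0 M) 2) :
    LevelSquarefullAt g := fun hg hcm ↦ h M g hg hcm

end Summit.BirchSwinnertonDyer.BirchSwinnertonDyer.Cruxes.ResidualThetaCountLowerPureAtTwo.SideaK4G13

end
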